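import Summits.QuantumFields.BalabanUV.T4Continuum.Support.NE9Lemma1PieceClass
import Summits.QuantumFields.BalabanUV.T4Continuum.Support.NE9Lemma1RemainderPiece
import Summits.QuantumFields.BalabanUV.T4Continuum.Support.NE9ComplexEncoding

/-!
# NE9Lemma1RemainderSpecies — the DISPLAYED species of [II] §1 as a class-relative piece form on the ANALYTIC CLASS (re/im
# encoding), with the per-piece bound `PieceBoundOnG` PROVED from analyticity ((I.3.54) ⊕ (1.24) ⊕ (1.25)): leaf S5 for that
# species is KERNEL modulo the domain inclusion (I.3.36), the level counts, and O1
# (cell `pub-balaban`, T4-DAG §2 node U3 / §6 NE9; lineage t4-ne9-p1 = row NE9 OWNER, generation 24; part 2 of 2)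

HONEST FRAMING (T4-DAG PAGE 1).  Rung (B)+1 of the FINITE-VOLUME T⁴ programme — NOT infinite volume, NOT a mass gap, NOT the
Clay problem.  NE9 (`T4OutputRate.NE9` ∧ `FadingMemory`) is a cell NEW ESTIMATE, NOT PRINTED, NOT discharged here; spine 0/9.
HONEST DEPENDENCY (cell line, verbatim): continuum YM on T⁴ ⇐ BetaPertH ∧ nine spine estimates (0/9 proved); BetaPertH ⇐ (D1)
∧ (D4) ∧ CAP+tail; G-an2-4 gates asym, D1 and NE2/3/4.  `FlowStep.BetaPertH`, (B), (B^μ) do not occur.  [I] = [Balaban1987RG1]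
(CMP **109**), [II] = [Balaban1988RG2Cluster] (CMP **116**) are quoted for TYPES only (ABSOLUTE RULE: nothing printed in the
audited series is asserted).

WHERE THIS SITS (skeleton `t4/b2b-balaban-t4-ne9-p1/SKELETON-NE9-P1.md` §3 row S5, §4 O-NE9-2).  Part 1 (`NE9Lemma1PieceClass`)
restated the piece form with the honest quantifier: the per-piece bound is asked ON THE ADMISSIBLE CLASS under the scale-j family
bound.  THIS FILE inhabits it with the displayed species — the pieces (1.23) p. 7 built on *"the last term on the right-hand side
of (I.3.34)"* (p. 2), the fifth-order Taylor remainder — on the carriers `NE9ComplexEncoding.doubleCarriers C` (every domain X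
in a `re` and an `im` copy) with backgrounds in a complex normed configuration space `E` (↔ 𝔘^c_j of [I] (1.11)–(1.14) p. 262):
* §1 the complex old term READ BACK from the doubled real family, `lift H X U = H U (X,re) + i·H U (X,im)`; the ANALYTIC CLASS
  `analyticClass R = {H | ∀ X, lift H X analytic on the ball of radius R X}` ([II] p. 7 *"All terms (1.23) … are defined and
  analytic on this space"*; [I] (1.18) p. 263) — closed under differences, one-step restrictions and truncations (the END's
  `AdmissibleTerms`-closure and `AdmRestrict` binders hold for it);
* §2 the datum `RemData` (index families; κ₁; the t_□-radii r_k of (1.22); the cubes Δ ⊂ Y₀∖□̃⁴; the contour directions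
  A(t, s, σ) ↔ (tζ̃_□ + t_□ζ_□)𝐇_k(σ(Y₀), B′) of (1.1)/(1.23); the analyticity radii R_X; direction size bounds a) and its piece
  form `RemData.toC`: piece at (X, re/im) := Re/Im of `NE9Lemma1RemainderPiece.remPiece e^{κ₁} r_k cubes (lift H X) 5 A s₀ σ₀`;
  `PieceZero` and `PieceLocal` PROVED (`remPiece` of the zero term vanishes; the piece reads the two copies of X only);
* §3 **`pieceBoundOnG_rem`**: under the binder structure `RemData.Admissible` — κ₁ ≥ 1, r_k > 0, R_X > 0, ‖A‖ ≤ a on the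
  contours, the DOMAIN INCLUSION a < R_X and a ≤ c_dir·ℓ k j·R_X ((I.3.36)–(3.53) p. 277–279: the fluctuation configuration seen
  from scale j is (α₁/α₃)L^jη-small relative to the analyticity radius — TYPE statements of the inductive spaces, displayed, NOT
  proved), the source discipline, and G1 (d_k(Y) ≤ d₀ + 4·#cubes, [II] (1.25)) — the class-relative per-piece bound
  `PieceBoundOnG (analyticClass R) D.toC κ κ₁ d₀ (Kp k = 64·c_dir⁵/r_k) (gain = ℓ⁵)` HOLDS: `norm_remPiece_le` (iterated Schwarz
  + `B13Sect1Arith.bound_124`) + `B13Sect1Arith.bound_125`, the input's size entering ONLY through the family bound on the two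
  copies of X (‖lift H X‖ ≤ |re| + |im| ≤ 2e^{−κd}N);
* §4 **`channelSizeAtStepNN_rem`**: leaf S5 = `ChannelSizeAtStepNN (analyticClass R) (cpieceChannel D.toC) κ wt τ` for the
  species, + `ChannelLocal`/`ChannelStepSum`, from part 1 BY NAME.  NOT PROVED here: `PieceAdditiveOn` (linearity of (1.23) in
  the old term: additivity of Taylor remainders of analytic slices and of the iterated contour integrals — an integrability side
  condition, kernel-routine, left to a part 3) — it is needed for `ChannelAdditive` (S3), not for S5.
So, for the displayed species, O-NE9-2 (S5 instance) is REDUCED to: O1 (Bałaban's pieces ARE `RemData.toC` of his (1.23) data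
on his 𝔘^c_j), the domain inclusion (I.3.36)–(3.53) as typed, the level counts (1.26)–(1.28), and additivity.  The OTHER species
([I] §4, gain (L^jη)^{4+β}) stay PROOF-INTERIOR.  DISGUISE TEST: one input family, one history; a size bound, not NE9.

References (TYPES only): [Balaban1988RG2Cluster] T. Bałaban, CMP **116** (1988) 1–22, p. 2, (1.1) p. 3, (1.22)–(1.25) p. 7,
(1.33)–(1.36) p. 9; [Balaban1987RG1] T. Bałaban, CMP **109** (1987) 249–301, (1.11)–(1.18) pp. 262–263, (3.34)–(3.36) p. 277,
(3.54) p. 280.  Summits-side NEW work (LEAN PLACEMENT RULE); imports parts `NE9Lemma1PieceClass`, `NE9Lemma1RemainderPiece`,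
`NE9ComplexEncoding` BY NAME; modifies nothing; 0 sorry.  Value = the displayed species' S5 leaf made kernel on the analytic
class modulo typed printed-TYPE binders, NOT summit progress.
-/

noncomputable section

namespace Summit.QuantumFields.BalabanUV.T4Continuum.NE9Lemma1RemainderSpecies

open scoped BigOperators
open Metric Set Complex
open Literature.MathematicalPhysics.QuantumFieldTheory.Balaban1983to89
open Literature.MathematicalPhysics.QuantumFieldTheory.Balaban1983to89.T4OutputRate
open Literature.MathematicalPhysics.QuantumFieldTheory.Balaban1983to89.T4HistoryLipschitzRecursion
open Literature.MathematicalPhysics.QuantumFieldTheory.Balaban1983to89.B13ExpansionOrder (tail_zero_fun)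
open Summit.QuantumFields.BalabanUV.T4Continuum.NE9Lemma1Counting
open Summit.QuantumFields.BalabanUV.T4Continuum.NE9Lemma1Gain
open Summit.QuantumFields.BalabanUV.T4Continuum.NE9Lemma1PieceClass
open Summit.QuantumFields.BalabanUV.T4Continuum.NE9Lemma1RemainderPiece
open Summit.QuantumFields.BalabanUV.T4Continuum.NE9ComplexEncoding (doubleCarriers)

variable {C : Carriers} {E : Type}

/-! ## §1 The complex old term read back from the doubled real family; the analytic class -/

/-- The complex-valued old term at the domain `X`, read back from a real family on the doubled carriers:
`lift H X U = H U (X, re) + i·H U (X, im)` (`NE9ComplexEncoding`: the `true` copy carries the real part). [folklore] -/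
def lift (H : E → (doubleCarriers C).Dom → ℝ) (X : C.Dom) : E → ℂ := fun U => ⟨H U (X, true), H U (X, false)⟩

/-- `lift` is additive in the family. [folklore] -/
theorem lift_sub (H₁ H₂ : E → (doubleCarriers C).Dom → ℝ) (X : C.Dom) : lift (H₁ - H₂) X = lift H₁ X - lift H₂ X := by
  funext U; apply Complex.ext <;> simp [lift]

/-- `lift 0 = 0`. [folklore] -/
theorem lift_zero (X : C.Dom) : lift (0 : E → (doubleCarriers C).Dom → ℝ) X = 0 := by
  funext U; rfl

/-- Two families agreeing on the creation-step slice of `X` have the same lift at `X`. [folklore] -/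
theorem lift_congr {H H' : E → (doubleCarriers C).Dom → ℝ} {X : C.Dom}
    (h : ∀ (U : E) (X' : (doubleCarriers C).Dom), (doubleCarriers C).scale X' = C.scale X → H U X' = H' U X') :
    lift H X = lift H' X := by
  funext U; apply Complex.ext
  · exact h U (X, true) rfl
  · exact h U (X, false) rfl

/-- The size of the lift from the family bound on the two copies: `‖lift H X U‖ ≤ |re| + |im| ≤ 2·B`. [folklore] -/
theorem norm_lift_le {H : E → (doubleCarriers C).Dom → ℝ} {X : C.Dom} {U : E} {B : ℝ}
    (hre : |H U (X, true)| ≤ B) (him : |H U (X, false)| ≤ B) : ‖lift H X U‖ ≤ 2 * B :=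
  calc ‖lift H X U‖ ≤ |(lift H X U).re| + |(lift H X U).im| := Complex.norm_le_abs_re_add_abs_im _
    _ ≤ B + B := add_le_add hre him
    _ = 2 * B := by ring

/-- The lift of a one-step restriction / truncation is the lift or zero. [folklore] -/
theorem lift_restrictScale (j : ℕ) (H : E → (doubleCarriers C).Dom → ℝ) (X : C.Dom) :
    lift (restrictScale (C := doubleCarriers C) j H) X = if C.scale X = j then lift H X else 0 := by
  funext U
  by_cases h : C.scale X = j
  · rw [if_pos h]; apply Complex.ext <;> simp [lift, restrictScale, doubleCarriers, h]
  · rw [if_neg h]; apply Complex.ext <;> simp [lift, restrictScale, doubleCarriers, h]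

/-- The lift of a truncation is the lift or zero. [folklore] -/
theorem lift_truncScale (k : ℕ) (H : E → (doubleCarriers C).Dom → ℝ) (X : C.Dom) :
    lift (truncScale (C := doubleCarriers C) k H) X = if C.scale X ≤ k then lift H X else 0 := by
  funext U
  by_cases h : C.scale X ≤ k
  · rw [if_pos h]; apply Complex.ext <;> simp [lift, truncScale, doubleCarriers, h]
  · rw [if_neg h]; apply Complex.ext <;> simp [lift, truncScale, doubleCarriers, h]

variable [NormedAddCommGroup E] [NormedSpace ℂ E]

/-- **THE ANALYTIC CLASS** on the doubled carriers: families whose complex read-back at every domain X is analytic on the ball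
of radius `R X` of the configuration space ([II] p. 7: *"All terms (1.23) with the localization domain Y are defined and analytic
on this space"*; [I] (1.18) p. 263 *"defined and analytic on the space U^c_j(X, α₀, α₁)"*). [cite: Balaban1987RG1, (1.18) p.263] -/
def analyticClass (R : C.Dom → ℝ) : Set (E → (doubleCarriers C).Dom → ℝ) :=
  {H | ∀ X : C.Dom, DifferentiableOn ℂ (lift H X) (ball 0 (R X))}

/-- The analytic class is closed under differences (the END's `AdmissibleTerms` second clause). [folklore] -/
theorem sub_mem_analyticClass {R : C.Dom → ℝ} {H₁ H₂ : E → (doubleCarriers C).Dom → ℝ}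
    (h₁ : H₁ ∈ analyticClass R) (h₂ : H₂ ∈ analyticClass R) : H₁ - H₂ ∈ analyticClass R := by
  intro X; rw [lift_sub]; exact (h₁ X).sub (h₂ X)

/-- **`AdmRestrict` FOR THE ANALYTIC CLASS**: closed under one-step restrictions and truncations. [folklore] -/
theorem admRestrict_analyticClass (R : C.Dom → ℝ) : AdmRestrict (C := doubleCarriers C) (analyticClass (E := E) R) := by
  refine ⟨fun H hH j X => ?_, fun H hH k X => ?_⟩
  · rw [lift_restrictScale]
    split_ifs
    · exact hH X
    · exact differentiableOn_const 0
  · rw [lift_truncScale]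
    split_ifs
    · exact hH X
    · exact differentiableOn_const 0

/-! ## §2 The datum of the displayed species and its piece form -/

/-- **THE DATUM OF THE DISPLAYED SPECIES** at FORM level: the index families of the piece form (on the doubled carriers), the
contour constant κ₁ (σ-circles of radius e^{κ₁}, (1.10)), the t_□-radii `r k` ((1.22) p. 7: 1/r = 8B₀C₁e^{16κ₁}α₂⁻¹g_k|B|), the
cubes Δ ⊂ Y₀∖□̃⁴ of each (□₀, Y₀), the contour DIRECTIONS `dir … t s σ` (↔ (tζ̃_□ + t_□ζ_□)𝐇_k(σ(Y₀), B′), (1.1) p. 3 / (1.23)),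
the analyticity radii `R X` of the old terms (𝔘^c_j(X, α₀, α₁), [I] (1.11)–(1.14)) and direction size bounds `dirB`.  No
inequality inside. [cite: Balaban1988RG2Cluster, (1.22)-(1.23) p.7] -/
structure RemData (C : Carriers) (E : Type) (ι α β γ δ : Type) where
  /-- boxes □₀ ⊂ Y -/
  S0 : ℕ → ι → Finset α
  /-- connected domains Y₀ ∋ □̃⁴ -/
  SY : ℕ → ι → α → Finset β
  /-- sources (X, re/im), X ∈ 𝐃_j, X ⊂ □̃² -/
  src : ℕ → ι → α → ℕ → Finset (doubleCarriers C).Dom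
  /-- counting cubes □′ -/
  Sq : ℕ → ι → α → ℕ → Finset γ
  /-- fibres X ⊃ □′ -/
  SX : ℕ → ι → α → ℕ → γ → Finset (doubleCarriers C).Dom
  /-- d_k(Y) -/
  dY : ℕ → ι → ℝ
  /-- κ₁ -/
  κ₁ : ℝ
  /-- t_□-radius r_k -/
  r : ℕ → ℝ
  /-- the cubes Δ ⊂ Y₀ ∖ □̃⁴ -/
  cubes : ℕ → ι → α → β → List δ
  /-- contour directions A(t, s, σ) -/
  dir : ℕ → (ℕ → ℝ) → ι → α → β → (doubleCarriers C).Dom → ℂ → (δ → ℝ) → (δ → ℂ) → E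
  /-- analyticity radius R_X -/
  R : C.Dom → ℝ
  /-- direction size bound a -/
  dirB : ℕ → (ℕ → ℝ) → ι → α → β → (doubleCarriers C).Dom → ℝ

variable {ι α β γ δ : Type} [DecidableEq δ]

/-- The contour constraint of (1.23) on the listed cubes: s(Δ) ∈ [0,1], |σ(Δ)| = e^{κ₁}. [cite: Balaban1988RG2Cluster, (1.10) p.4] -/
def OnContour (κ₁ : ℝ) (l : List δ) (s : δ → ℝ) (σ : δ → ℂ) : Prop :=
  ∀ i ∈ l, s i ∈ Icc (0:ℝ) 1 ∧ σ i ∈ sphere (0:ℂ) (Real.exp κ₁)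

omit [DecidableEq δ] in
/-- The base point `s ≡ 0`, `σ ≡ e^{κ₁}` satisfies the contour constraint (all listed coordinates are integrated out, so the
piece may be read at any admissible base point). [folklore] -/
theorem onContour_base (κ₁ : ℝ) (l : List δ) :
    OnContour κ₁ l (fun _ => (0:ℝ)) (fun _ => ((Real.exp κ₁ : ℝ) : ℂ)) := by
  intro i _
  refine ⟨⟨le_rfl, zero_le_one⟩, ?_⟩
  simp

/-- Real or imaginary part according to the copy. [folklore] -/
def reIm (b : Bool) (z : ℂ) : ℝ := if b then z.re else z.im

/-- `|reIm b z| ≤ ‖z‖`. [folklore] -/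
theorem abs_reIm_le (b : Bool) (z : ℂ) : |reIm b z| ≤ ‖z‖ := by
  cases b
  · exact Complex.abs_im_le_norm z
  · exact Complex.abs_re_le_norm z

/-- `reIm b 0 = 0`. [folklore] -/
theorem reIm_zero (b : Bool) : reIm b 0 = 0 := by cases b <;> simp [reIm]

/-- **THE PIECE FORM OF THE DISPLAYED SPECIES**: volumes = number of cubes; piece at the source (X, re/im) := Re/Im of the
(1.23)-functional `remPiece e^{κ₁} r_k cubes (lift H X) 5 dir s₀ σ₀` of the FIFTH-ORDER Taylor remainder of the complex old term
along the contour directions (`NE9Lemma1RemainderPiece`). [cite: Balaban1988RG2Cluster, (1.23) p.7] -/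
def RemData.toC (D : RemData C E ι α β γ δ) : CPieceData (doubleCarriers C) E ι α β γ where
  S0 := D.S0
  SY := D.SY
  src := D.src
  Sq := D.Sq
  SX := D.SX
  vol := fun k y a b => ((D.cubes k y a b).length : ℝ)
  dY := D.dY
  piece := fun k s y a b x H => reIm x.2
    (remPiece (Real.exp D.κ₁) (D.r k) (D.cubes k y a b) (lift H x.1) 5 (D.dir k s y a b x)
      (fun _ => (0:ℝ)) (fun _ => ((Real.exp D.κ₁ : ℝ) : ℂ)))

/-- The directional Taylor remainder of the zero term vanishes. [folklore] -/
theorem dirRem_zero (n : ℕ) (A : E) : dirRem (0 : E → ℂ) n A = 0 := by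
  unfold dirRem taylorRem taylorHead
  have h0 : (fun τ : ℂ => (0 : E → ℂ) (τ • A)) = 0 := by funext τ; rfl
  rw [h0]
  simp [tail_zero_fun]

/-- The iterated Cauchy operation of (1.23) applied to the zero integrand vanishes. [folklore] -/
theorem cauchyOp_zero (ρ : ℝ) : ∀ (l : List δ) (s : δ → ℝ) (σ : δ → ℂ),
    B13Sect1Arith.cauchyOp ρ l (fun _ _ => (0 : ℂ)) s σ = 0
  | [], _, _ => rfl
  | i :: l, s, σ => by
    simp only [B13Sect1Arith.cauchyOp, cauchyOp_zero ρ l, smul_zero, circleIntegral, intervalIntegral.integral_zero]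

/-- The (1.23)-functional of the zero term vanishes. [folklore] -/
theorem remPiece_zero (ρ r : ℝ) (l : List δ) (n : ℕ) (A : ℂ → (δ → ℝ) → (δ → ℂ) → E) (s : δ → ℝ) (σ : δ → ℂ) :
    remPiece ρ r l (0 : E → ℂ) n A s σ = 0 := by
  unfold remPiece
  simp only [dirRem_zero, cauchyOp_zero, smul_zero, circleIntegral, intervalIntegral.integral_zero]

/-- **`PieceZero` FOR THE DISPLAYED SPECIES.** [folklore] -/
theorem pieceZero_rem (D : RemData C E ι α β γ δ) : PieceZero D.toC := by
  intro k s y a b x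
  show reIm x.2 (remPiece _ _ _ (lift (0 : E → (doubleCarriers C).Dom → ℝ) x.1) 5 _ _ _) = 0
  rw [lift_zero, remPiece_zero, reIm_zero]

/-- **`PieceLocal` FOR THE DISPLAYED SPECIES**: the piece sourced at (X, ·) reads the family on the two copies of X only, both
of creation step `scale X`. [folklore] -/
theorem pieceLocal_rem (D : RemData C E ι α β γ δ) : PieceLocal D.toC := by
  intro k s y a b x H H' hHH'
  show reIm x.2 (remPiece _ _ _ (lift H x.1) 5 _ _ _) = reIm x.2 (remPiece _ _ _ (lift H' x.1) 5 _ _ _)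
  rw [lift_congr hHH']

/-! ## §3 The per-piece bound PROVED on the analytic class -/

/-- **THE BINDERS OF THE DISPLAYED SPECIES** (printed TYPE statements and bookkeeping, displayed — NOT proved here):
`κ₁ ≥ 1`; `r_k > 0`; `R_X > 0`; the directions are bounded by `dirB` on the contours; the DOMAIN INCLUSION `dirB < R_X` and
`dirB ≤ c_dir·ℓ k j·R_X` ([I] (3.36) p. 277 with (3.37)–(3.53): *"(tζ̃_□ + t_□ζ_□)𝐇_k(σ)B′"* lies in the analyticity domain
with the relative size (α₁/α₃)L^jη — `ℓ k j ↔ L^jη`, `c_dir ↔ α₁/α₃`); the SOURCE DISCIPLINE (sources under j have creation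
step j); G1 ([II] (1.25) p. 7: d_k(Y) ≤ d_k(□₀) + 4·M⁻⁴|Y₀∖□̃⁴|, with `d₀` for d_k(□₀) ≥ 0); `c_dir ≥ 0`.
[cite: Balaban1987RG1, (3.36) p.277; Balaban1988RG2Cluster, (1.25) p.7] -/
structure RemData.Admissible (D : RemData C E ι α β γ δ) (ℓ : ℕ → ℕ → ℝ) (cdir d0 : ℝ) : Prop where
  κ₁_ge : 1 ≤ D.κ₁
  r_pos : ∀ k, 0 < D.r k
  R_pos : ∀ X, 0 < D.R X
  dir_le : ∀ k s y a b x, ∀ t ∈ sphere (0:ℂ) (D.r k), ∀ s' σ',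
    OnContour D.κ₁ (D.cubes k y a b) s' σ' → ‖D.dir k s y a b x t s' σ'‖ ≤ D.dirB k s y a b x
  dirB_lt : ∀ k s y a b x, D.dirB k s y a b x < D.R x.1
  dirB_le : ∀ k s y, ∀ a ∈ D.S0 k y, ∀ b ∈ D.SY k y a, ∀ j, ∀ x ∈ D.src k y a j,
    D.dirB k s y a b x ≤ cdir * ℓ k j * D.R x.1
  srcScale : ∀ k y a j, ∀ x ∈ D.src k y a j, C.scale x.1 = j
  G1 : ∀ k y, ∀ a ∈ D.S0 k y, ∀ b ∈ D.SY k y a, D.dY k y ≤ d0 + 4 * ((D.cubes k y a b).length : ℝ)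
  d0_nonneg : 0 ≤ d0
  cdir_nonneg : 0 ≤ cdir

/-- The source discipline of the datum is part 1's `CSrcScale`. [folklore] -/
theorem csrcScale_rem {D : RemData C E ι α β γ δ} {ℓ : ℕ → ℕ → ℝ} {cdir d0 : ℝ} (hD : D.Admissible ℓ cdir d0) :
    CSrcScale D.toC :=
  fun k y a j x hx => hD.srcScale k y a j x hx

/-- The constant of the species: `Kp k y = 64·c_dir⁵/r_k` (2⁵ from the iterated Schwarz lemma, 2 from |re| + |im|, 1/r_k from
(1.22), c_dir⁵ ↔ (α₁/α₃)⁵ of (1.24)). [folklore] -/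
def KpOf (D : RemData C E ι α β γ δ) (cdir : ℝ) : ℕ → ι → ℝ := fun k _ => 64 * cdir ^ 5 / D.r k

omit [NormedSpace ℂ E] [DecidableEq δ] in
/-- `0 ≤ KpOf`. [folklore] -/
theorem kpOf_nonneg {D : RemData C E ι α β γ δ} {ℓ : ℕ → ℕ → ℝ} {cdir d0 : ℝ} (hD : D.Admissible ℓ cdir d0) (k : ℕ)
    (y : ι) : 0 ≤ KpOf D cdir k y :=
  div_nonneg (mul_nonneg (by norm_num) (pow_nonneg hD.cdir_nonneg 5)) (hD.r_pos k).le

/-- **THE PER-PIECE BOUND OF THE DISPLAYED SPECIES, PROVED ON THE ANALYTIC CLASS** ((I.3.54) ⊕ [II] (1.24) ⊕ (1.25) at FORM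
level): `PieceBoundOnG (analyticClass R) D.toC κ κ₁ d₀ (KpOf D c_dir) (ℓ⁵)` — for an analytic family whose creation-step-j slice is
bounded by `e^{−κd}·N`, the piece sourced at (X, re/im) is bounded by `(64c_dir⁵/r_k)·N·(ℓ k j)⁵·e^{−κd(X)}·exp(−⅛(κ₁−1)d_k(Y) +
⅛κ₁d₀ − ½(κ₁−1)·#cubes)`.  Chain: |Re/Im| ≤ ‖·‖; `norm_remPiece_le` (analyticity of `lift H X` on the ball of radius R_X, its
size ≤ 2e^{−κd}N there from the family bound on BOTH copies of X, directions ≤ dirB < R_X); `(dirB/R_X)⁵ ≤ (c_dir·ℓ)⁵`;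
`B13Sect1Arith.bound_125` under G1.  The gain comes from the INPUT's analyticity — exactly what the class-free gen-23 binder could
not express (part 1 §4). [cite: Balaban1987RG1, (3.54) p.280; Balaban1988RG2Cluster, (1.24)-(1.25) p.7] -/
theorem pieceBoundOnG_rem {D : RemData C E ι α β γ δ} {ℓ : ℕ → ℕ → ℝ} {cdir d0 : ℝ} (hD : D.Admissible ℓ cdir d0)
    (hℓ : ∀ k j, 0 ≤ ℓ k j) (κ : ℝ) :
    PieceBoundOnG (analyticClass D.R) D.toC κ D.κ₁ d0 (KpOf D cdir) (fun k j => ℓ k j ^ 5) := by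
  intro k s y a ha b hb j x hx H hH N hN hbd
  -- letters
  set X : C.Dom := x.1 with hXdef
  set l := D.cubes k y a b with hl
  set M : ℝ := 2 * (Real.exp (-(κ * C.d X)) * N) with hM
  have hj : C.scale X = j := hD.srcScale k y a j x hx
  -- the size of the complex old term on the ball, from the family bound on both copies of X
  have hMbd : ∀ z ∈ ball (0 : E) (D.R X), ‖lift H X z‖ ≤ M := by
    intro z _
    exact norm_lift_le (hbd z (X, true) hj) (hbd z (X, false) hj)
  -- the remainder-piece bound (iterated Schwarz + bound_124)
  have hrem := norm_remPiece_le (n := 5) hD.κ₁_ge (hD.r_pos k) (hH X) hMbd (hD.dirB_lt k s y a b x) l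
    (D.dir k s y a b x) (fun t ht s' σ' hsσ => hD.dir_le k s y a b x t ht s' σ' hsσ) _ _ (onContour_base D.κ₁ l)
  -- nonnegativity of the direction bound (read at one contour point)
  have hdirB0 : 0 ≤ D.dirB k s y a b x := by
    have ht : ((D.r k : ℝ) : ℂ) ∈ sphere (0:ℂ) (D.r k) := by simp [abs_of_pos (hD.r_pos k)]
    exact (norm_nonneg _).trans (hD.dir_le k s y a b x _ ht _ _ (onContour_base D.κ₁ l))
  have hRpos : 0 < D.R X := hD.R_pos X
  -- (dirB / R)^5 ≤ (c_dir ℓ)^5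
  have hratio : (D.dirB k s y a b x / D.R X) ^ 5 ≤ (cdir * ℓ k j) ^ 5 := by
    refine pow_le_pow_left₀ (div_nonneg hdirB0 hRpos.le) ?_ 5
    rw [div_le_iff₀ hRpos]
    exact hD.dirB_le k s y a ha b hb j x hx
  -- (1.25)
  have h125 := B13Sect1Arith.bound_125 (N := (l.length : ℝ)) (dY := D.dY k y) hD.κ₁_ge hD.d0_nonneg
    (hD.G1 k y a ha b hb)
  have hM0 : 0 ≤ M := by rw [hM]; exact mul_nonneg zero_le_two (mul_nonneg (Real.exp_pos _).le hN)
  have h32M : 0 ≤ 2 ^ 5 * M := mul_nonneg (by norm_num) hM0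
  have hcl : 0 ≤ (cdir * ℓ k j) ^ 5 := pow_nonneg (mul_nonneg hD.cdir_nonneg (hℓ k j)) 5
  have hr0 : 0 < D.r k := hD.r_pos k
  -- assemble
  show |reIm x.2 (remPiece (Real.exp D.κ₁) (D.r k) (D.cubes k y a b) (lift H x.1) 5 (D.dir k s y a b x)
      (fun _ => (0:ℝ)) (fun _ => ((Real.exp D.κ₁ : ℝ) : ℂ)))| ≤ KpOf D cdir k y * N * ℓ k j ^ 5 *
        Real.exp (-(κ * (doubleCarriers C).d x)) *
          Real.exp (-(1 / 8) * (D.κ₁ - 1) * D.toC.dY k y + (1 / 8) * D.κ₁ * d0 -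
            (1 / 2) * (D.κ₁ - 1) * D.toC.vol k y a b)
  have hdx : (doubleCarriers C).d x = C.d X := rfl
  have hdY : D.toC.dY k y = D.dY k y := rfl
  have hvol : D.toC.vol k y a b = (l.length : ℝ) := rfl
  rw [hdx, hdY, hvol, ← hXdef, ← hl]
  calc |reIm x.2 (remPiece (Real.exp D.κ₁) (D.r k) l (lift H X) 5 (D.dir k s y a b x) (fun _ => (0:ℝ))
          (fun _ => ((Real.exp D.κ₁ : ℝ) : ℂ)))|
        ≤ ‖remPiece (Real.exp D.κ₁) (D.r k) l (lift H X) 5 (D.dir k s y a b x) (fun _ => (0:ℝ))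
          (fun _ => ((Real.exp D.κ₁ : ℝ) : ℂ))‖ := abs_reIm_le _ _
    _ ≤ 1 / D.r k * (2 ^ 5 * M * (D.dirB k s y a b x / D.R X) ^ 5) * Real.exp (-(D.κ₁ - 1) * l.length) := hrem
    _ ≤ 1 / D.r k * (2 ^ 5 * M * (cdir * ℓ k j) ^ 5) *
          Real.exp (-(1 / 8) * (D.κ₁ - 1) * D.dY k y + (1 / 8) * D.κ₁ * d0 - (1 / 2) * (D.κ₁ - 1) * l.length) := by
        refine mul_le_mul ?_ h125 (Real.exp_pos _).le ?_
        · exact mul_le_mul_of_nonneg_left (mul_le_mul_of_nonneg_left hratio h32M) (div_pos one_pos hr0).le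
        · exact mul_nonneg (div_pos one_pos hr0).le (mul_nonneg h32M hcl)
    _ = KpOf D cdir k y * N * ℓ k j ^ 5 * Real.exp (-(κ * C.d X)) *
          Real.exp (-(1 / 8) * (D.κ₁ - 1) * D.dY k y + (1 / 8) * D.κ₁ * d0 - (1 / 2) * (D.κ₁ - 1) * l.length) := by
        simp only [KpOf, hM]; ring

/-! ## §4 Leaf S5 (+ locality, step-sum, restriction-closure) for the displayed species on the analytic class -/

/-- **LEAF S5 FOR THE DISPLAYED SPECIES ON THE ANALYTIC CLASS (the point of the module)**:
`ChannelSizeAtStepNN (analyticClass R) (cpieceChannel D.toC) κ (weightOf D.toC.frame κ₁ d₀ O1 (KpOf D c_dir)) (tauOfG c_Q ℓ′)`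
from the binders `RemData.Admissible` (printed TYPE: domain inclusion, G1, radii) and the level counts of [II] p. 8 with gain ℓ⁵
— part 1's `channelSizeAtStepNN_cpieceG` fed with `pieceZero_rem`, `pieceLocal_rem`, `csrcScale_rem` and the PROVED
`pieceBoundOnG_rem`.  Printed letters: ℓ = L^jη, c_Q = (6L)⁴, ℓ′ k j = L^jη (the displayed species has α = 1: τ k j = (6L)⁴L^jη,
p. 8 l. 9–10). [cite: Balaban1988RG2Cluster, (1.24)-(1.29) pp.7-8, (1.36) p.9] -/
theorem channelSizeAtStepNN_rem {D : RemData C E ι α β γ δ} {ℓ ℓ' : ℕ → ℕ → ℝ} {cdir d0 O1 cQ : ℝ}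
    (hD : D.Admissible ℓ cdir d0) (hℓ : ∀ k j, 0 ≤ ℓ k j) (κ : ℝ)
    (hL : LevelCountsG D.toC.frame κ D.κ₁ O1 cQ (fun k j => ℓ k j ^ 5) ℓ') (hO1 : 0 ≤ O1)
    (hcQℓ : ∀ k j, 0 ≤ cQ * ℓ' k j) :
    ChannelSizeAtStepNN (analyticClass D.R) (cpieceChannel D.toC) κ (weightOf D.toC.frame D.κ₁ d0 O1 (KpOf D cdir))
      (tauOfG cQ ℓ') :=
  channelSizeAtStepNN_cpieceG (pieceZero_rem D) (pieceLocal_rem D) (csrcScale_rem hD) (pieceBoundOnG_rem hD hℓ κ) hL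
    (kpOf_nonneg hD) hO1 (fun k j => pow_nonneg (hℓ k j) 5) hcQℓ

/-- `ChannelLocal` and `ChannelStepSum` for the species' channel on ANY class (part 1, from zero/locality/source discipline);
`AdmRestrict` for the analytic class (§1). [folklore] -/
theorem structureBinders_rem {D : RemData C E ι α β γ δ} {ℓ : ℕ → ℕ → ℝ} {cdir d0 : ℝ} (hD : D.Admissible ℓ cdir d0)
    (Adm : Set (E → (doubleCarriers C).Dom → ℝ)) :
    ChannelLocal Adm (cpieceChannel D.toC) ∧ ChannelStepSum Adm (cpieceChannel D.toC) ∧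
      AdmRestrict (C := doubleCarriers C) (analyticClass (E := E) D.R) :=
  ⟨channelLocal_cpiece (pieceLocal_rem D) (csrcScale_rem hD) Adm,
    channelStepSum_cpiece (pieceZero_rem D) (pieceLocal_rem D) (csrcScale_rem hD) Adm, admRestrict_analyticClass D.R⟩

/-- **WHAT S3 STILL NEEDS** (displayed, honest): `ChannelAdditive (analyticClass R) (cpieceChannel D.toC)` follows from
`PieceAdditiveOn (analyticClass R) D.toC` (part 1 `channelAdditive_cpiece`) — the linearity of (1.23) in the old term (Taylor
remainders of analytic slices are additive; the iterated contour integrals are additive on integrable, e.g. continuous,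
integrands).  Recorded as the implication; the hypothesis is the integrability side condition of the instantiation.
[cite: Balaban1988RG2Cluster, (1.23) p.7] -/
theorem channelAdditive_rem_of_pieceAdditive {D : RemData C E ι α β γ δ}
    (hA : PieceAdditiveOn (analyticClass D.R) D.toC) : ChannelAdditive (analyticClass D.R) (cpieceChannel D.toC) :=
  channelAdditive_cpiece hA

end Summit.QuantumFields.BalabanUV.T4Continuum.NE9Lemma1RemainderSpecies
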